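import Mathlib
import Literature.Analysis.FluidPDE.VectorCalculus
import HarnessLib

/-!
# Route `EfficiencyFloor`, crux `MaximiserSetRigidity` (stmt-NavierStokesRegularity-25512), part (b)
# "no normalised maximiser is a relative equilibrium": the ALGEBRAIC HALF via the ENSTROPHY balance —
# a normalised Lu–Doering maximiser has `S − ν·Pal = (27c⁴/(256ν³))·Z³ > 0`, so the only self-similar rate compatible
# with an enstrophy balance `S − ν·Pal = (c′/2)·Z` is `c′ = (27c⁴/(128ν³))·Z² > 0`

Helper file (`--supports stmt-NavierStokesRegularity-25512 --as helper`; first helper on that item; route-independent imports).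
Part (b) of the item forbids, for every normalised maximiser `m` (`S(m) = c⋆Z^{3/4}Pal^{3/4}`, `Pal(m) = (81c⋆⁴/(256ν⁴))Z(m)³`,
`Z(m) > 0`), the relative-equilibrium profile equation
`νΔm − (m·∇)m − ∇π = (a·∇)m + ((Wx)·∇)m − Wm + c′(m + (x·∇)m)` (`W` skew). PRESSURE-FREE ROUTE (this file's proposal for
the Lean port): take the curl — `curl ∇π = 0`, `curl((m·∇)m) = (m·∇)ω − (ω·∇)m`, `curl((a·∇)m) = (a·∇)ω`,
`curl(((Wx)·∇)m − Wm) = ((Wx)·∇)ω − Wω`, `curl(m + (x·∇)m) = 2ω + (x·∇)ω` (`ω = curl m`) — and test against `ω` with the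
radial cut-offs of the tree's `integral_divergence_eq_zero_of_integrable(_div)` (`WholeSpaceIBPIntegrable`,
`PineauVicolEnstrophy`): every transport term integrates to zero (`div m = 0`, `tr W = 0`, `⟨Wω,ω⟩ = 0`),
`∫⟨(x·∇)ω, ω⟩ = −(3/2)Z`, and one obtains the **ENSTROPHY BALANCE OF THE PROFILE**

  `S(m) − ν·Pal(m) = (c′/2)·Z(m)`                                                         (EB)

(the stationary form of `Ż = 2S − 2ν·Pal` along the relative equilibrium `t ↦ g(t)·m`). (EB) is the analytic half, NOT
proved here (size L with the tree's whole-space IBP tools; no Liouville theorem and no pressure estimate is needed).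
THIS FILE PROVES THE ALGEBRAIC HALF, which turns (EB) into the item's conclusion for `c′ ≤ 0` and pins the remaining case:

* `production_sub_dissipation_of_normalised` — for reals `c ≥ 0`, `ν > 0`, `Z ≥ 0`, `Pal ≥ 0` with
  `S = cZ^{3/4}Pal^{3/4}` and `Pal = (81c⁴/(256ν⁴))Z³`: `S − ν·Pal = (27c⁴/(256ν³))·Z³` (so `2S − 2ν·Pal = K·Z³`,
  `K = 27c⁴/(128ν³)`: a normalised maximiser SATURATES the cubic law exactly);
* `production_sub_dissipation_pos` — hence `S − ν·Pal > 0` when `c, Z > 0`;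
* `rate_eq_of_enstrophyBalance` — if moreover `S − ν·Pal = (c′/2)·Z` with `Z > 0` then `c′ = (27c⁴/(128ν³))·Z²`;
* `not_rate_nonpos_of_enstrophyBalance` — in particular `c′ ≤ 0` (steady / travelling / rigidly rotating / expanding
  profiles) is impossible: the cases the item's docstring attributes to the energy equality, here WITHOUT the pressure;
* `of_normalisedMaximiser` (§2) — the same for an admissible field under the item's normalised-maximiser clause verbatim.

READING. After (EB), part (b) of stmt-25512 is EXACTLY: no normalised maximiser is a rotating/travelling BACKWARD
SELF-SIMILAR profile collapsing at its own Lu–Doering rate `c′ = K·Z(m)²` — the `c′ > 0` case, Pineau–Vicol (arXiv:2607.09619)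
RSS-Liouville territory (tree: `pineauVicol2026_rss_liouville`, hypotheses to be matched). HONEST FRAMING: real algebra about a
HYPOTHETICAL maximiser; (EB), stmt-25512, `RigidExit` (25513), `LerayFloorGap`, `ProductionEfficiencyDecay` and Navier–Stokes
regularity stay OPEN; no summit statement is proved. [folklore]
-/

-- the problem directory repeats the summit name (`NavierStokesRegularity/NavierStokesRegularity`)
set_option linter.dupNamespace false

noncomputable section

namespace Summit.NavierStokesRegularity.NavierStokesRegularity.Theorems

namespace MaximiserSetRigidity

namespace EnstrophyBalance

open MeasureTheory
open scoped InnerProductSpace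
open Literature.Analysis.FluidPDE

/-! ### §1 Real algebra of a normalised maximiser -/

section algebra

variable {c ν Z P S c' : ℝ}

/-- **A normalised maximiser saturates the cubic law: `S − ν·Pal = (27c⁴/(256ν³))·Z³`.** For `c ≥ 0`, `ν > 0`,
`Z, Pal ≥ 0` with `S = cZ^{3/4}Pal^{3/4}` and `Pal = (81c⁴/(256ν⁴))Z³`. (With `b = Pal^{1/4}`, `a = Z^{3/4}`: the
normalisation is `b = (3c/(4ν))·a`, and `S − ν·Pal = a⁴(3c/(4ν))³(c − 3c/4)`.) [folklore] -/
theorem production_sub_dissipation_of_normalised (hc : 0 ≤ c) (hν : 0 < ν) (hZ : 0 ≤ Z) (hP : 0 ≤ P)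
    (hS : S = c * Z ^ (3 / 4 : ℝ) * P ^ (3 / 4 : ℝ)) (hN : P = 81 * c ^ 4 / (256 * ν ^ 4) * Z ^ 3) :
    S - ν * P = 27 * c ^ 4 / (256 * ν ^ 3) * Z ^ 3 := by
  set b : ℝ := P ^ (1 / 4 : ℝ) with hb_def
  set a : ℝ := Z ^ (3 / 4 : ℝ) with ha_def
  have hb : 0 ≤ b := Real.rpow_nonneg hP _
  have ha : 0 ≤ a := Real.rpow_nonneg hZ _
  have hP1 : P = b ^ 4 := by
    rw [hb_def, ← Real.rpow_mul_natCast hP]; norm_num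
  have hP34 : P ^ (3 / 4 : ℝ) = b ^ 3 := by
    rw [hb_def, ← Real.rpow_mul_natCast hP]; norm_num
  have hZ3 : Z ^ 3 = a ^ 4 := by
    rw [ha_def, ← Real.rpow_mul_natCast hZ]; norm_num
  set Y : ℝ := 3 * c / (4 * ν) with hY_def
  have hY : 0 ≤ Y := by positivity
  -- the normalisation in quarter powers: `b = Y a`
  have hb4 : b ^ 4 = (Y * a) ^ 4 := by
    rw [← hP1, hN, hZ3, hY_def]; field_simp; ring
  have hbYa : b = Y * a := (pow_left_inj₀ hb (mul_nonneg hY ha) (by norm_num : (4 : ℕ) ≠ 0)).1 hb4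
  -- substitute
  rw [hS, hP34, hP1, hbYa, hZ3, hY_def]
  field_simp
  ring

/-- **Hence `S − ν·Pal > 0` for a normalised maximiser with `c, Z > 0`.** [folklore] -/
theorem production_sub_dissipation_pos (hc : 0 < c) (hν : 0 < ν) (hZ : 0 < Z) (hP : 0 ≤ P)
    (hS : S = c * Z ^ (3 / 4 : ℝ) * P ^ (3 / 4 : ℝ)) (hN : P = 81 * c ^ 4 / (256 * ν ^ 4) * Z ^ 3) :
    0 < S - ν * P := by
  rw [production_sub_dissipation_of_normalised hc.le hν hZ.le hP hS hN]
  positivity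

/-- **The enstrophy balance pins the self-similar rate.** If a normalised maximiser (`c ≥ 0`, `ν > 0`, `Z > 0`, `Pal ≥ 0`,
`S = cZ^{3/4}Pal^{3/4}`, `Pal = (81c⁴/(256ν⁴))Z³`) satisfies the profile enstrophy balance `S − ν·Pal = (c′/2)·Z`, then
`c′ = (27c⁴/(128ν³))·Z²`. [folklore] -/
theorem rate_eq_of_enstrophyBalance (hc : 0 ≤ c) (hν : 0 < ν) (hZ : 0 < Z) (hP : 0 ≤ P)
    (hS : S = c * Z ^ (3 / 4 : ℝ) * P ^ (3 / 4 : ℝ)) (hN : P = 81 * c ^ 4 / (256 * ν ^ 4) * Z ^ 3)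
    (hEB : S - ν * P = c' / 2 * Z) : c' = 27 * c ^ 4 / (128 * ν ^ 3) * Z ^ 2 := by
  have h := production_sub_dissipation_of_normalised hc hν hZ.le hP hS hN
  rw [hEB] at h
  -- `(c′/2) Z = (27c⁴/(256ν³)) Z³`, divide by `Z/2 > 0`
  have hZne : Z ≠ 0 := hZ.ne'
  field_simp at h
  have h2 : (c' * (128 * ν ^ 3) - 27 * c ^ 4 * Z ^ 2) * Z = 0 := by nlinarith [h]
  have h3 : c' * (128 * ν ^ 3) - 27 * c ^ 4 * Z ^ 2 = 0 := by
    rcases mul_eq_zero.1 h2 with h | h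
    · exact h
    · exact absurd h hZne
  field_simp
  linarith

/-- **No normalised maximiser is a steady / travelling / rigidly rotating / expanding profile**, GIVEN the enstrophy
balance: with `c > 0`, `Z > 0`, the balance `S − ν·Pal = (c′/2)·Z` is impossible for `c′ ≤ 0`. [folklore] -/
theorem not_rate_nonpos_of_enstrophyBalance (hc : 0 < c) (hν : 0 < ν) (hZ : 0 < Z) (hP : 0 ≤ P)
    (hS : S = c * Z ^ (3 / 4 : ℝ) * P ^ (3 / 4 : ℝ)) (hN : P = 81 * c ^ 4 / (256 * ν ^ 4) * Z ^ 3)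
    (hEB : S - ν * P = c' / 2 * Z) : 0 < c' := by
  rw [rate_eq_of_enstrophyBalance hc.le hν hZ hP hS hN hEB]
  positivity

end algebra

/-! ### §2 For an admissible field under the item's normalised-maximiser clause -/

/-- **The algebraic half of `MaximiserSetRigidity` (b), for a field.** Let `c > 0`, `ν > 0` and let `m` satisfy the item's
normalised-maximiser clause verbatim (`0 < Z(m)`, `S(m) = c·Z(m)^{3/4}·Pal(m)^{3/4}`, `Pal(m) = (81c⁴/(256ν⁴))·Z(m)³`, with
`Z = ∫‖curl m‖²`, `Pal = ∫|∇curl m|²_F`, `S = ∫⟨curl m, ∇m·curl m⟩`). Then `S(m) − ν·Pal(m) = (27c⁴/(256ν³))·Z(m)³ > 0`, and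
for every real `c′`: the enstrophy balance `S(m) − ν·Pal(m) = (c′/2)·Z(m)` forces `c′ = (27c⁴/(128ν³))·Z(m)² > 0`. The
balance itself (for profiles solving the item's relative-equilibrium equation) is NOT proved here. [folklore] -/
theorem of_normalisedMaximiser (c ν : ℝ) (hc : 0 < c) (hν : 0 < ν)
    (m : EuclideanSpace ℝ (Fin 3) → EuclideanSpace ℝ (Fin 3))
    (hZ : 0 < ∫ x, ‖curl m x‖ ^ 2)
    (hS : (∫ x, ⟪curl m x, fderiv ℝ m x (curl m x)⟫_ℝ) =
      c * (∫ x, ‖curl m x‖ ^ 2) ^ (3 / 4 : ℝ) * (∫ x, frobeniusNormSq (fderiv ℝ (curl m) x)) ^ (3 / 4 : ℝ))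
    (hN : (∫ x, frobeniusNormSq (fderiv ℝ (curl m) x)) = 81 * c ^ 4 / (256 * ν ^ 4) * (∫ x, ‖curl m x‖ ^ 2) ^ 3) :
    (∫ x, ⟪curl m x, fderiv ℝ m x (curl m x)⟫_ℝ) - ν * (∫ x, frobeniusNormSq (fderiv ℝ (curl m) x)) =
        27 * c ^ 4 / (256 * ν ^ 3) * (∫ x, ‖curl m x‖ ^ 2) ^ 3 ∧
      0 < (∫ x, ⟪curl m x, fderiv ℝ m x (curl m x)⟫_ℝ) - ν * (∫ x, frobeniusNormSq (fderiv ℝ (curl m) x)) ∧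
      ∀ c' : ℝ, (∫ x, ⟪curl m x, fderiv ℝ m x (curl m x)⟫_ℝ) - ν * (∫ x, frobeniusNormSq (fderiv ℝ (curl m) x)) =
          c' / 2 * (∫ x, ‖curl m x‖ ^ 2) →
        c' = 27 * c ^ 4 / (128 * ν ^ 3) * (∫ x, ‖curl m x‖ ^ 2) ^ 2 ∧ 0 < c' := by
  have hP : 0 ≤ ∫ x, frobeniusNormSq (fderiv ℝ (curl m) x) :=
    integral_nonneg fun x => frobeniusNormSq_nonneg _
  exact ⟨production_sub_dissipation_of_normalised hc.le hν hZ.le hP hS hN,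
    production_sub_dissipation_pos hc hν hZ hP hS hN,
    fun c' hEB => ⟨rate_eq_of_enstrophyBalance hc.le hν hZ hP hS hN hEB,
      not_rate_nonpos_of_enstrophyBalance hc hν hZ hP hS hN hEB⟩⟩

end EnstrophyBalance

end MaximiserSetRigidity

end Summit.NavierStokesRegularity.NavierStokesRegularity.Theorems

end
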